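import Mathlib
import Summits.Ventures.HodgeRepro2.T5LocalSelfDuality
import Summits.Ventures.HodgeRepro2.T5AdditiveConductor

/-!
# The annihilator of a ball: the continuous characters trivial on `B b` are exactly the shifts
  `ψ(t·)` with `t ∈ B (c − b)`

`K` a complete `Valued ℤᵐ⁰` field with finite-index balls and every `exp j` attained, `ψ` continuous
non-trivial of conductor `c` (trivial on `B c`, not on `B (c+1)`).  Under the pairing
`(t, x) ↦ ψ(t x)` the annihilator of the ball `B b` is the ball `B (c − b)`:

* `forall_eq_one_iff_val_le`: `ψ(t·)` is trivial on `B b` ⟺ `v t ≤ exp (c − b)`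
  (`T5BallCharacters`);
* `setOf_continuous_eq_one_on_eq`: `{χ continuous ∣ χ = 1 on B b} = {ψ(t·) ∣ t ∈ B (c − b)}`
  (self-duality, `T5LocalSelfDuality`);
* `conductorExp_mulShift_eq`: the conductor of `ψ(t·)` is `c − log (v t)` — Lemma N5.L4(i)'s
  «`n(ψ^t) = n(ψ) + v_E(t)`» in the language of `T5AdditiveConductor.conductorExp`.

Declaration per README §8(d): «uses an L-value-free non-vanishing device: NO».
-/

namespace Summit.Ventures.HodgeRepro2.T5BallAnnihilator

open WithZero T5BallCharacters T5LocalSelfDuality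

variable {K : Type*} [Field K] [Valued K ℤᵐ⁰]

section Pairing

variable (ψ : AddChar K Circle) {c : ℤ}

/-- `ψ(t·)` is trivial on `B b` ⟺ `v t ≤ exp (c − b)`. -/
theorem forall_eq_one_iff_val_le (hψ1 : ∀ x : K, Valued.v x ≤ exp c → ψ x = 1)
    (hψ2 : ∃ y : K, Valued.v y ≤ exp (c + 1) ∧ ψ y ≠ 1) (t : K) (b : ℤ) :
    (∀ x : K, Valued.v x ≤ exp b → ψ (t * x) = 1) ↔ Valued.v t ≤ exp (c - b) :=
  ⟨val_le_of_forall_mulShift_eq_one ψ hψ2, forall_mulShift_eq_one_of_val_le ψ hψ1⟩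

/-- The shift `ψ(t·)` is continuous when `ψ` is. -/
theorem continuous_mulShift (hψc : Continuous ψ) (t : K) : Continuous (ψ.mulShift t) := by
  have : ((ψ.mulShift t : AddChar K Circle) : K → Circle) = fun x => ψ (t * x) := by
    funext x
    exact AddChar.mulShift_apply
  rw [this]
  exact hψc.comp (continuous_const.mul continuous_id)

end Pairing

section Annihilator

variable [CompleteSpace K] (ψ : AddChar K Circle)

/-- THE ANNIHILATOR OF A BALL: the continuous characters trivial on `B b` are exactly the shifts of
`ψ` by `t ∈ B (c − b)`, `c` the conductor of `ψ`. -/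
theorem setOf_continuous_eq_one_on_eq
    (hfin : ∀ a b : ℤ, b ≤ a → (ball (K := K) b).relIndex (ball a) ≠ 0)
    (hval : ∀ j : ℤ, ∃ u : K, Valued.v u = exp j) (hψc : Continuous ψ) {c : ℤ}
    (hψ1 : ∀ x : K, Valued.v x ≤ exp c → ψ x = 1)
    (hψ2 : ∃ y : K, Valued.v y ≤ exp (c + 1) ∧ ψ y ≠ 1) (b : ℤ) :
    {χ : AddChar K Circle | Continuous χ ∧ ∀ x : K, Valued.v x ≤ exp b → χ x = 1} =
      (fun t => ψ.mulShift t) '' {t : K | Valued.v t ≤ exp (c - b)} := by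
  have hψ : ψ ≠ 1 := by
    obtain ⟨y, _, hy⟩ := hψ2
    exact fun h => hy (by rw [h, AddChar.one_apply])
  ext χ
  constructor
  · rintro ⟨hχc, hχ⟩
    obtain ⟨t, ht⟩ := exists_forall_eq_mulShift hfin hval ψ hψc hψ χ hχc
    refine ⟨t, ?_, ?_⟩
    · show Valued.v t ≤ exp (c - b)
      rw [← forall_eq_one_iff_val_le ψ hψ1 hψ2]
      intro x hx
      rw [← ht x]
      exact hχ x hx
    · exact AddChar.ext _ _ fun x => by rw [AddChar.mulShift_apply, ht x]
  · rintro ⟨t, ht, rfl⟩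
    refine ⟨continuous_mulShift ψ hψc t, fun x hx => ?_⟩
    rw [AddChar.mulShift_apply]
    exact forall_mulShift_eq_one_of_val_le ψ hψ1 ht x hx

end Annihilator

section Conductor

open T5AdditiveConductor

variable (ψ : AddChar K Circle) {c : ℤ}

/-- Lemma N5.L4(i) in the `conductorExp` language: `n(ψ(t·)) = n(ψ) − log (v t)` for `t ≠ 0`. -/
theorem conductorExp_mulShift_eq (hψ1 : ∀ x : K, Valued.v x ≤ exp c → ψ x = 1)
    (hψ2 : ∃ y : K, Valued.v y ≤ exp (c + 1) ∧ ψ y ≠ 1) {t : K} (ht : t ≠ 0) :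
    conductorExp (ψ.mulShift t) (Valued.v : Valuation K ℤᵐ⁰) = c - (Valued.v t).log := by
  have hvt : Valued.v t ≠ 0 := by simpa using ht
  set j := (Valued.v t).log with hj
  have hj' : Valued.v t = exp j := (exp_log hvt).symm
  apply conductorExp_eq_of
  · intro x hx
    rw [AddChar.mulShift_apply]
    exact forall_mulShift_eq_one_of_val_le ψ hψ1 (by rw [hj']; exact le_of_eq (by ring_nf)) x hx
  · intro h
    have h' : ∀ x : K, Valued.v x ≤ exp (c - j + 1) → ψ (t * x) = 1 := fun x hx => by
      rw [← AddChar.mulShift_apply]; exact h x hx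
    have := val_le_of_forall_mulShift_eq_one ψ hψ2 h'
    rw [hj', exp_le_exp] at this
    omega
  · obtain ⟨y, hy, hy1⟩ := hψ2
    refine ⟨y / t, ?_⟩
    rw [AddChar.mulShift_apply, mul_div_cancel₀ y ht]
    exact hy1

end Conductor

end Summit.Ventures.HodgeRepro2.T5BallAnnihilator
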